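import Summits.BirchSwinnertonDyer.BirchSwinnertonDyer.Theorems.KatoDescentPotSupersingularCartanMuRoadRealDoors
import Summits.BirchSwinnertonDyer.BirchSwinnertonDyer.Theorems.Rank1ResidualIntModelReduction
import Literature.NumberTheory.EllipticCurves.SemistableModPImageIrreducibleProofs
import Literature.NumberTheory.EllipticCurves.SupersingularDensitySerreTraceProofs
import Literature.NumberTheory.EllipticCurves.ModPIrreducibleCongruenceTransferProofs
import Literature.NumberTheory.SerreUniformity.Statement
import Mathlib.LinearAlgebra.Matrix.GeneralLinearGroup.Card
import HarnessLib

/-!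
# KERNEL CERTIFICATE for «mod-3 image EQUAL to the normaliser of a non-split Cartan subgroup»
# (`HasModPImageEqNonsplitCartanNormalizer W 3`, obsanat's `3Nn`) from: `W[3]` irreducible, `ρ̄₃` not onto, and ONE element
# `σ ∈ Γ_ℚ` with `σ² = ±σ + 1` on `W[3]` (an order-8 element, e.g. a Frobenius at a good `ℓ ≡ 2 (mod 3)` with `3 ∤ a_ℓ`)
# (cell `bsd-potss`, seat `bsd-potss-k9-c4` g18; route-free; `--supports` 19942; closes nothing)

HONEST FRAMING. THEOREMS ONLY (no definition, no named fact, no `sorry`). Serre 1972 §2: a subgroup `G ⊂ GL₂(𝔽₃)` of order prime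
to `3` which is irreducible lies in a Sylow `2`-subgroup `C_ns⁺(3)` (order `16`); the tree has the dichotomy «`3 ∣ #G ⟹ G = GL₂(𝔽₃)`
or `G` Borel» (`WeierstrassCurve.not_dvd_card_of_not_hasSurjectiveModNGaloisRep`, Serre §2.4 Prop. 15) so for `W[3]` irreducible and
`ρ̄₃` not onto `#G ∣ 16`. If moreover some `σ` acts on `W[3]` with `σ² = sσ + 1` (`s = ±1`: the minimal polynomial of a generator of
`𝔽₉ˣ`, so `ρ̄(σ)` has order `8`) then with a complex conjugation `c` (an involution `≠ ±1`, this seat's `CartanMuRoadRealDoors`) the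
sixteen elements `ρ̄(c)^β ρ̄(σ)^i` are distinct, so they exhaust `G`; in the basis `(v, w)`, `v = T + cT ≠ 0`, `w = −σv − sv`, one
gets `ρ̄(σ) = (−s, 1; −1, −s) ∈ C_ns(−1)` and (closure under `c σ c`) `ρ̄(c) = diag(1, −1)`, and `{ρ̄(c)^β ρ̄(σ)^i}` is EXACTLY the
tree's `SerreUniformity.nonsplitCartanNormalizer (−1)` — all finite checks by `decide` on `2 × 2` matrices over `𝔽₃`. Main theorem:
`hasModPImageEqNonsplitCartanNormalizer_three_of_sq_eq`; Frobenius form `…_of_frobenius` (`tr ρ̄₃(Frob_ℓ) = a_ℓ`, `det = ℓ`, tree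
theorems `trace/det_galoisRepTorsion_frobenius_eq`). Used per row on the `3Nn` residue rows of K9's 19942. Nothing about any curve is
asserted here.

References: [Serre1972] §2.2–§2.6, §5.2; [Zywina2015] §1.2 (`N_ns(3)`); [SilvermanAEC2009] III.§7; [Serre1981] §8.1 (238).
-/

set_option linter.dupNamespace false
set_option autoImplicit false

noncomputable section

open scoped Classical
open Matrix Field WeierstrassCurve Literature.NumberTheory.EllipticCurves Literature.NumberTheory.GaloisRepresentations
  Literature.NumberTheory.SerreUniformity

namespace Summit.BirchSwinnertonDyer.BirchSwinnertonDyer.Theorems.ModThreeNonsplitCartanCertificate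

/-! ### §1 Finite facts in `M₂(𝔽₃)` (all by `decide`) -/

/-- The second column of `U` is forced by `U² = sU + 1` and the first column `(−s, −1)`. [folklore] -/
private theorem key_Mu : ∀ (t x y : ZMod 3), (t = 1 ∨ t = -1) →
    !![-t, x; -1, y] * !![-t, x; -1, y] = t • !![-t, x; -1, y] + 1 → x = 1 ∧ y = -t := by decide

/-- An involution `≠ 1` with first column `(1, 0)` is `(1, x; 0, −1)`. [folklore] -/
private theorem key_Mc : ∀ (x y : ZMod 3), !![(1 : ZMod 3), x; 0, y] * !![1, x; 0, y] = 1 → !![(1 : ZMod 3), x; 0, y] ≠ 1 →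
    y = -1 := by decide

/-- The sixteen products `C^β U^i` (`β < 2`, `i < 8`) are pairwise distinct. [folklore] -/
private theorem key_inj : ∀ (t x : ZMod 3), (t = 1 ∨ t = -1) → ∀ (β β' : Fin 2) (i j : Fin 8),
    !![(1 : ZMod 3), x; 0, -1] ^ (β : ℕ) * !![-t, 1; -1, -t] ^ (i : ℕ) =
      !![(1 : ZMod 3), x; 0, -1] ^ (β' : ℕ) * !![-t, 1; -1, -t] ^ (j : ℕ) → β = β' ∧ i = j := by decide

/-- Closure under `C U C` forces `x = 0`. [folklore] -/
private theorem key_closed : ∀ (t x : ZMod 3), (t = 1 ∨ t = -1) → ∀ (β : Fin 2) (i : Fin 8),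
    !![(1 : ZMod 3), x; 0, -1] * !![-t, 1; -1, -t] * !![1, x; 0, -1] =
      !![(1 : ZMod 3), x; 0, -1] ^ (β : ℕ) * !![-t, 1; -1, -t] ^ (i : ℕ) → x = 0 := by decide

/-- Every `C^β U^i` is in the normal form of `C_ns⁺(−1)`. [cite: Serre1972, §2.2] -/
private theorem key_mem : ∀ (t : ZMod 3), (t = 1 ∨ t = -1) → ∀ (β : Fin 2) (i : Fin 8), ∃ a b : ZMod 3, (a, b) ≠ (0, 0) ∧
    (!![(1 : ZMod 3), 0; 0, -1] ^ (β : ℕ) * !![-t, 1; -1, -t] ^ (i : ℕ) = !![a, (-1) * b; b, a] ∨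
      !![(1 : ZMod 3), 0; 0, -1] ^ (β : ℕ) * !![-t, 1; -1, -t] ^ (i : ℕ) = !![a, -((-1) * b); b, -a]) := by decide

/-- Conversely every element of `C_ns⁺(−1)` is some `C^β U^i`. [cite: Serre1972, §2.2] -/
private theorem key_surj : ∀ (t : ZMod 3), (t = 1 ∨ t = -1) → ∀ (a b : ZMod 3), (a, b) ≠ (0, 0) →
    (∃ (β : Fin 2) (i : Fin 8), !![a, (-1) * b; b, a] = !![(1 : ZMod 3), 0; 0, -1] ^ (β : ℕ) * !![-t, 1; -1, -t] ^ (i : ℕ)) ∧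
    (∃ (β : Fin 2) (i : Fin 8), !![a, -((-1) * b); b, -a] = !![(1 : ZMod 3), 0; 0, -1] ^ (β : ℕ) * !![-t, 1; -1, -t] ^ (i : ℕ)) := by
  decide

/-- `μ² − sμ − 1 ≠ 0` in `𝔽₃` for `s = ±1`: `X² − sX − 1` is irreducible mod `3`. [folklore] -/
private theorem key_irred : ∀ (t μ : ZMod 3), (t = 1 ∨ t = -1) → μ * μ - t * μ - 1 ≠ 0 := by decide

/-- `#GL₂(𝔽₃) = 48`. [folklore] -/
private theorem card_GL_two_zmod_three : Nat.card (GL (Fin 2) (ZMod 3)) = 48 := by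
  rw [Matrix.card_GL_field]
  simp [ZMod.card, Fin.prod_univ_two]

/-! ### §2 The certificate -/

/-- Two matrices with the same action on all vectors `e T` are equal. [folklore] -/
private theorem matrix_eq_of_forall_mulVec {A : Type*} [AddCommGroup A] (e : A ≃+ (Fin 2 → ZMod 3))
    {M N : Matrix (Fin 2) (Fin 2) (ZMod 3)} (h : ∀ T : A, M *ᵥ e T = N *ᵥ e T) : M = N :=
  Matrix.toLin'.injective (LinearMap.ext fun v => by
    rw [Matrix.toLin'_apply, Matrix.toLin'_apply, ← e.apply_symm_apply v, h])

/-- **`3Nn` certificate.** Let `W/ℚ` be elliptic with `W[3]` irreducible and `ρ̄_{W,3}` not surjective, and let `σ ∈ Γ_ℚ` act on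
`W[3]` with `σ(σT) = s·σT + T` for `s ∈ {1, −1}`. Then the mod-`3` image EQUALS the normaliser of a non-split Cartan subgroup:
`HasModPImageEqNonsplitCartanNormalizer W 3`. [cite: Serre1972, §2.2, §2.4 Prop. 15, §2.6, §5.2 (iv)] [cite: Zywina2015, §1.2] -/
theorem hasModPImageEqNonsplitCartanNormalizer_three_of_sq_eq (W : WeierstrassCurve ℚ) [W.IsElliptic]
    (hirr : W.HasIrreducibleModPGaloisRep 3) (hns : ¬ W.HasSurjectiveModNGaloisRep 3)
    {σ : absoluteGaloisGroup ℚ} {s : ZMod 3} (hs : s = 1 ∨ s = -1)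
    (hσ : letI : Module (ZMod 3) (W.geomTorsion (3 : ℕ)) := AddSubgroup.torsionBy.zmodModule
      ∀ P : W.geomTorsion (3 : ℕ), σ • (σ • P) = s • (σ • P) + P) :
    HasModPImageEqNonsplitCartanNormalizer W 3 := by
  letI inst : Module (ZMod 3) (geomTorsion W ((3 : ℕ) : ℤ)) := AddSubgroup.torsionBy.zmodModule
  -- the action commutes with the `𝔽₃`-scalars
  have hsm : ∀ (τ : absoluteGaloisGroup ℚ) (k : ZMod 3) (P : geomTorsion W ((3 : ℕ) : ℤ)), τ • (k • P) = k • (τ • P) :=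
    fun τ k P => ((DistribSMul.toAddMonoidHom (geomTorsion W ((3 : ℕ) : ℤ)) τ).toZModLinearMap 3).map_smul k P
  -- a complex conjugation and the first basis vector
  obtain ⟨c, hc⟩ := exists_isComplexConjugation (Rat.castHom ℝ)
  have hc2 : ∀ T : geomTorsion W ((3 : ℕ) : ℤ), c • (c • T) = T := CartanMuRoadRealDoors.smul_smul_of_isComplexConjugation hc
  obtain ⟨T₀, hT₀⟩ := CartanMuRoadRealDoors.exists_smul_ne_neg_of_isComplexConjugation (W := W) (ℓ := 3) (by decide) hc
  obtain ⟨T₁, hT₁⟩ := CartanMuRoadRealDoors.exists_smul_ne_of_isComplexConjugation (W := W) (ℓ := 3) (by decide) hc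
  obtain ⟨v, hvdef⟩ : ∃ v : geomTorsion W ((3 : ℕ) : ℤ), v = T₀ + c • T₀ := ⟨_, rfl⟩
  have hv0 : v ≠ 0 := fun h => hT₀ (eq_neg_of_add_eq_zero_right (hvdef ▸ h))
  have hcv : c • v = v := by rw [hvdef, smul_add, hc2, add_comm]
  obtain ⟨w, hwdef⟩ : ∃ w : geomTorsion W ((3 : ℕ) : ℤ), w = -(σ • v) - s • v := ⟨_, rfl⟩
  have hσv : σ • v = -w - s • v := by rw [hwdef]; abel
  have hσw : σ • w = v - s • w := by
    have e1 : σ • w = -(s • (σ • v) + v) - s • (σ • v) := by rw [hwdef, smul_sub, smul_neg, hσ v, hsm]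
    rw [e1, hwdef]
    generalize σ • v = u
    rcases hs with rfl | rfl <;> match_scalars <;> decide
  -- `(v, w)` is a basis
  have hli : LinearIndependent (ZMod 3) ![v, w] := by
    rw [LinearIndependent.pair_iff' hv0]
    intro a h
    have h1 : σ • v = (-a - s) • v := by rw [hσv, ← h]; module
    have h2 : ((-a - s) * (-a - s) - s * (-a - s) - 1) • v = 0 := by
      have e1 : σ • (σ • v) = ((-a - s) * (-a - s)) • v := by rw [h1, hsm, h1, smul_smul]
      have e2 : σ • (σ • v) = (s * (-a - s) + 1) • v := by rw [hσ v, h1, smul_smul, add_smul, one_smul]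
      rw [sub_smul, sub_smul, one_smul, ← e1]
      rw [e2, add_smul, one_smul]; abel
    rcases smul_eq_zero.mp h2 with h0 | h0
    · exact key_irred s (-a - s) hs h0
    · exact hv0 h0
  have hrank : Module.finrank (ZMod 3) (geomTorsion W ((3 : ℕ) : ℤ)) = 2 := W.finrank_geomTorsion_eq_two 3 (by norm_num)
  haveI : FiniteDimensional (ZMod 3) (geomTorsion W ((3 : ℕ) : ℤ)) := .of_finrank_pos (by omega)
  have hcard : Fintype.card (Fin 2) = Module.finrank (ZMod 3) (geomTorsion W ((3 : ℕ) : ℤ)) := by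
    rw [Fintype.card_fin, hrank]
  let bas := basisOfLinearIndependentOfCardEqFinrank hli hcard
  have hbas0 : bas 0 = v := by simp only [bas, coe_basisOfLinearIndependentOfCardEqFinrank, Matrix.cons_val_zero]
  have hbas1 : bas 1 = w := by
    simp only [bas, coe_basisOfLinearIndependentOfCardEqFinrank, Matrix.cons_val_one, Matrix.cons_val_zero]
  let eL : geomTorsion W ((3 : ℕ) : ℤ) ≃ₗ[ZMod 3] (Fin 2 → ZMod 3) := bas.equivFun
  have he1 : eL v = Pi.single 0 1 := by ext i; rw [← hbas0]; simp [eL, Module.Basis.equivFun_self, Pi.single_apply, eq_comm]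
  have he2 : eL w = Pi.single 1 1 := by ext i; rw [← hbas1]; simp [eL, Module.Basis.equivFun_self, Pi.single_apply, eq_comm]
  -- matrices of additive automorphisms in the basis
  let Mat : Multiplicative (AddAut (geomTorsion W ((3 : ℕ) : ℤ))) → Matrix (Fin 2) (Fin 2) (ZMod 3) := fun g =>
    LinearMap.toMatrix' (eL.toLinearMap ∘ₗ (g.toAdd.toAddMonoidHom.toZModLinearMap 3) ∘ₗ eL.symm.toLinearMap)
  have hMat : ∀ g (P : geomTorsion W ((3 : ℕ) : ℤ)), eL (g.toAdd P) = Mat g *ᵥ eL P := by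
    intro g P
    rw [← Matrix.toLin'_apply, Matrix.toLin'_toMatrix']
    simp only [LinearMap.coe_comp, LinearEquiv.coe_coe, Function.comp_apply, LinearEquiv.symm_apply_apply]
    rfl
  have hMat_mul : ∀ g h, Mat (g * h) = Mat g * Mat h := fun g h =>
    matrix_eq_of_forall_mulVec eL.toAddEquiv fun T => by
      change Mat (g * h) *ᵥ eL T = (Mat g * Mat h) *ᵥ eL T
      rw [← Matrix.mulVec_mulVec, ← hMat, ← hMat, ← hMat]; rfl
  have hMat_one : Mat 1 = 1 := matrix_eq_of_forall_mulVec eL.toAddEquiv fun T => by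
    change Mat 1 *ᵥ eL T = (1 : Matrix (Fin 2) (Fin 2) (ZMod 3)) *ᵥ eL T
    rw [← hMat, Matrix.one_mulVec]; rfl
  have hMat_pow : ∀ g (n : ℕ), Mat (g ^ n) = Mat g ^ n := by
    intro g n; induction n with
    | zero => rw [pow_zero, pow_zero, hMat_one]
    | succ n ih => rw [pow_succ, pow_succ, hMat_mul, ih]
  have hMat_inj : Function.Injective Mat := by
    intro g h hgh
    refine Multiplicative.toAdd.injective (AddEquiv.ext fun P => eL.injective ?_)
    rw [hMat, hMat, hgh]
  set ρ := galoisRepTorsion W ((3 : ℕ) : ℤ) with hρdef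
  have hmem : ∀ τ : absoluteGaloisGroup ℚ, ρ τ ∈ ρ.range := fun τ => MonoidHom.mem_range.mpr ⟨τ, rfl⟩
  have hρ : ∀ (τ : absoluteGaloisGroup ℚ) (P : geomTorsion W ((3 : ℕ) : ℤ)), (ρ τ).toAdd P = τ • P := fun τ P => rfl
  have hM : ∀ (τ : absoluteGaloisGroup ℚ) (P : geomTorsion W ((3 : ℕ) : ℤ)), eL (τ • P) = Mat (ρ τ) *ᵥ eL P :=
    fun τ P => by rw [← hρ, hMat]
  -- the matrix of `σ`
  set Mu := Mat (ρ σ) with hMudef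
  have hMu_sq : Mu * Mu = s • Mu + 1 := matrix_eq_of_forall_mulVec eL.toAddEquiv fun T => by
    change (Mu * Mu) *ᵥ eL T = (s • Mu + 1) *ᵥ eL T
    rw [← Matrix.mulVec_mulVec, ← hM, ← hM, hσ T, Matrix.add_mulVec, Matrix.smul_mulVec, Matrix.one_mulVec, ← hM,
      map_add, map_smul]
  have hMu_col : Mu *ᵥ Pi.single 0 1 = ![-s, -1] := by
    rw [← he1, ← hM, hσv, map_sub, map_neg, map_smul, he1, he2]
    ext i; fin_cases i <;> simp
  have hMu00 : Mu 0 0 = -s := by simpa [Matrix.mulVec, dotProduct, Pi.single_apply] using congrFun hMu_col 0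
  have hMu10 : Mu 1 0 = -1 := by simpa [Matrix.mulVec, dotProduct, Pi.single_apply] using congrFun hMu_col 1
  have hMu : Mu = !![-s, 1; -1, -s] := by
    have hη := Matrix.eta_fin_two Mu
    rw [hMu00, hMu10] at hη
    obtain ⟨hx, hy⟩ := key_Mu s (Mu 0 1) (Mu 1 1) hs (by rw [← hη]; exact hMu_sq)
    rw [hη, hx, hy]
  -- the matrix of `c`
  set Mc := Mat (ρ c) with hMcdef
  have hMc_sq : Mc * Mc = 1 := by
    rw [hMcdef, ← hMat_mul, ← hMat_one]
    congr 1
    refine Multiplicative.toAdd.injective (AddEquiv.ext fun P => ?_)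
    change (ρ c).toAdd ((ρ c).toAdd P) = P
    rw [hρ, hρ, hc2]
  have hMc_ne : Mc ≠ 1 := fun h => hT₁ (eL.injective (by rw [hM, ← hMcdef, h, Matrix.one_mulVec]))
  have hMc_col : Mc *ᵥ Pi.single 0 1 = ![1, 0] := by
    rw [← he1, ← hM, hcv, he1]; ext i; fin_cases i <;> simp
  have hMc00 : Mc 0 0 = 1 := by simpa [Matrix.mulVec, dotProduct, Pi.single_apply] using congrFun hMc_col 0
  have hMc10 : Mc 1 0 = 0 := by simpa [Matrix.mulVec, dotProduct, Pi.single_apply] using congrFun hMc_col 1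
  set x := Mc 0 1 with hxdef
  have hMc' : Mc = !![1, x; 0, -1] := by
    have hη := Matrix.eta_fin_two Mc
    rw [hMc00, hMc10] at hη
    have hy := key_Mc (Mc 0 1) (Mc 1 1) (by rw [← hη]; exact hMc_sq) (by rw [← hη]; exact hMc_ne)
    rw [hη, hy]
  -- counting: `#ρ̄(Γ_ℚ) ∣ 16`
  obtain ⟨e₀, Φ₀, he₀, -, -, -, -⟩ := exists_frame_galoisRepTorsion_rat W 3
  have hN3 : ¬ 3 ∣ Nat.card ρ.range := by
    have h := not_dvd_card_of_not_hasSurjectiveModNGaloisRep W 3 Φ₀ e₀ he₀ hirr hns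
    rwa [card_map_range_galoisRepTorsion] at h
  have hN48 : Nat.card ρ.range ∣ 16 * 3 := by
    have h1 := Subgroup.card_subgroup_dvd_card ρ.range
    rwa [Nat.card_congr Φ₀.toEquiv, card_GL_two_zmod_three] at h1
  have hN16 : Nat.card ρ.range ∣ 16 :=
    (Nat.Coprime.symm ((Nat.Prime.coprime_iff_not_dvd Nat.prime_three).mpr hN3)).dvd_of_dvd_mul_right hN48
  haveI : Finite ρ.range := Nat.finite_of_card_ne_zero (fun h => by rw [h] at hN16; norm_num at hN16)
  -- the sixteen elements `ρ̄(c)^β ρ̄(σ)^i`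
  let f : Fin 2 × Fin 8 → ρ.range := fun βi =>
    ⟨ρ c ^ (βi.1 : ℕ) * ρ σ ^ (βi.2 : ℕ), mul_mem (pow_mem (hmem c) _) (pow_mem (hmem σ) _)⟩
  have hfMat : ∀ βi, Mat (f βi : Multiplicative (AddAut (geomTorsion W ((3 : ℕ) : ℤ)))) =
      !![(1 : ZMod 3), x; 0, -1] ^ (βi.1 : ℕ) * !![-s, 1; -1, -s] ^ (βi.2 : ℕ) := by
    intro βi
    change Mat (ρ c ^ (βi.1 : ℕ) * ρ σ ^ (βi.2 : ℕ)) = _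
    rw [hMat_mul, hMat_pow, hMat_pow, ← hMcdef, ← hMudef, hMc', hMu]
  have hf : Function.Injective f := by
    rintro ⟨β, i⟩ ⟨β', j⟩ h
    have h' := congrArg (fun z : ρ.range => Mat (z : Multiplicative (AddAut (geomTorsion W ((3 : ℕ) : ℤ))))) h
    simp only [hfMat] at h'
    obtain ⟨h1, h2⟩ := key_inj s x hs β β' i j h'
    rw [h1, h2]
  have h16 : 16 ≤ Nat.card ρ.range := by
    have h := Nat.card_le_card_of_injective f hf
    simpa [Nat.card_prod] using h
  have hN : Nat.card ρ.range = 16 := Nat.le_antisymm (Nat.le_of_dvd (by norm_num) hN16) h16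
  have hfbij : Function.Bijective f := hf.bijective_of_nat_card_le (by rw [hN]; simp)
  have hform : ∀ τ : absoluteGaloisGroup ℚ, ∃ (β : Fin 2) (i : Fin 8),
      Mat (ρ τ) = !![(1 : ZMod 3), x; 0, -1] ^ (β : ℕ) * !![-s, 1; -1, -s] ^ (i : ℕ) := by
    intro τ
    obtain ⟨⟨β, i⟩, hβi⟩ := hfbij.2 ⟨ρ τ, hmem τ⟩
    refine ⟨β, i, ?_⟩
    rw [← hfMat (β, i), hβi]
  -- closure forces `x = 0`
  have hx0 : x = 0 := by
    obtain ⟨β, i, h⟩ := hform (c * σ * c)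
    rw [map_mul, map_mul, hMat_mul, hMat_mul, ← hMcdef, ← hMudef, hMc', hMu] at h
    exact key_closed s x hs β i h
  have hMc : Mc = !![1, 0; 0, -1] := by rw [hMc', hx0]
  -- assemble
  refine ⟨eL.toAddEquiv, -1, by decide, fun τ => ?_, fun M hMN => ?_⟩
  · obtain ⟨β, i, h⟩ := hform τ
    rw [hx0] at h
    obtain ⟨a, b, hab, hor⟩ := key_mem s hs β i
    refine ⟨Mat (ρ τ), ⟨a, b, hab, ?_⟩, fun P => hM τ P⟩
    rw [h]; exact hor
  · obtain ⟨a, b, hab, hor⟩ := hMN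
    obtain ⟨⟨β, i, h1⟩, ⟨β', i', h2⟩⟩ := key_surj s hs a b hab
    rcases hor with rfl | rfl
    · refine ⟨c ^ (β : ℕ) * σ ^ (i : ℕ), fun P => ?_⟩
      change eL ((c ^ (β : ℕ) * σ ^ (i : ℕ)) • P) = _ *ᵥ eL P
      rw [hM, map_mul, map_pow, map_pow, hMat_mul, hMat_pow, hMat_pow, ← hMcdef, ← hMudef, hMc, hMu, ← h1]
    · refine ⟨c ^ (β' : ℕ) * σ ^ (i' : ℕ), fun P => ?_⟩
      change eL ((c ^ (β' : ℕ) * σ ^ (i' : ℕ)) • P) = _ *ᵥ eL P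
      rw [hM, map_mul, map_pow, map_pow, hMat_mul, hMat_pow, hMat_pow, ← hMcdef, ← hMudef, hMc, hMu, ← h2]

/-! ### §3 The order-8 element from a Frobenius: `tr = a_ℓ ≢ 0`, `det = ℓ ≡ −1 (mod 3)` -/

/-- Cayley–Hamilton for `2 × 2` matrices: `M² = (tr M)·M − (det M)·1`. [folklore] -/
private theorem mul_self_eq_trace_smul_sub_det {R : Type*} [CommRing R] (M : Matrix (Fin 2) (Fin 2) R) :
    M * M = M.trace • M - M.det • (1 : Matrix (Fin 2) (Fin 2) R) := by
  ext i j
  fin_cases i <;> fin_cases j <;>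
    simp [Matrix.mul_apply, Fin.sum_univ_two, Matrix.trace_fin_two, Matrix.det_fin_two] <;> ring

open NumberField IsDedekindDomain Rat.HeightOneSpectrum in
/-- **An element of order `8` on `W[3]` from a Frobenius.** `W/ℚ` elliptic, globally minimal; `ℓ ≠ 3` a prime of good reduction with
`ℓ ≡ −1 (mod 3)` and `a_ℓ ≡ s (mod 3)`: every arithmetic Frobenius `σ` at a prime above `ℓ` satisfies `σ(σT) = s·σT + T` on `W[3]`
(`tr ρ̄₃(σ) = a_ℓ`, `det ρ̄₃(σ) = ℓ`, Cayley–Hamilton); for `s = ±1` this is the minimal polynomial of a generator of `𝔽₉ˣ`.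
[cite: Serre1981, §8.1 (238)] [cite: DarmonDiamondTaylor1995, Prop. 2.8 (a)] -/
theorem exists_smul_smul_eq_of_frobeniusTrace (W : WeierstrassCurve ℚ) [W.IsElliptic] [W.IsGloballyMinimal]
    (ℓ : ℕ) [hℓ : Fact ℓ.Prime] (hℓ3 : ℓ ≠ 3) (hgood : W.HasGoodReductionAtPrime ℓ) {s : ZMod 3}
    (htr : ((W.frobeniusTrace ℓ : ℤ) : ZMod 3) = s) (hℓm : ((ℓ : ℕ) : ZMod 3) = -1) :
    letI : Module (ZMod 3) (W.geomTorsion (3 : ℕ)) := AddSubgroup.torsionBy.zmodModule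
    ∃ σ : absoluteGaloisGroup ℚ, ∀ P : W.geomTorsion (3 : ℕ), σ • (σ • P) = s • (σ • P) + P := by
  letI inst : Module (ZMod 3) (geomTorsion W ((3 : ℕ) : ℤ)) := AddSubgroup.torsionBy.zmodModule
  -- a Frobenius at a prime above `ℓ`
  obtain ⟨v, hv⟩ : ∃ v : HeightOneSpectrum (𝓞 ℚ), (primesEquiv v : ℕ) = ℓ :=
    ⟨primesEquiv.symm ⟨ℓ, hℓ.out⟩, by rw [Equiv.apply_symm_apply]⟩
  obtain ⟨𝔓, h𝔓⟩ := HeightOneSpectrum.primesAbove_nonempty v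
  obtain ⟨σ, hσ⟩ := HeightOneSpectrum.exists_isArithFrobAt_of_mem_primesAbove_holds h𝔓
  refine ⟨σ, fun P => ?_⟩
  -- a frame and the matrix of `σ`
  have h3' : ((3 : ℕ) : AlgebraicClosure ℚ) ≠ 0 := by norm_num
  have hcard : Nat.card (geomTorsion W ((3 : ℕ) : ℤ)) = 3 ^ 2 := card_torsionPoints_eq_sq_holds W (AlgebraicClosure ℚ) (n := 3) h3'
  obtain ⟨e, Φ, he, htrΦ, hdetΦ⟩ := exists_addEquiv_mulEquiv_addAut_GL2 (geomTorsion W ((3 : ℕ) : ℤ)) hcard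
  set M : Matrix (Fin 2) (Fin 2) (ZMod 3) :=
    ((Φ (galoisRepTorsion W ((3 : ℕ) : ℤ) σ) : GL (Fin 2) (ZMod 3)) : Matrix (Fin 2) (Fin 2) (ZMod 3)) with hMdef
  have htrM : M.trace = s := by
    rw [hMdef, htrΦ, W.trace_galoisRepTorsion_frobenius_eq 3 hℓ3 hgood hv h𝔓 hσ, htr]
  have hdetM : M.det = -1 := by
    rw [hMdef, hdetΦ, W.det_galoisRepTorsion_frobenius_eq 3 hℓ3 hgood hv h𝔓 hσ, hℓm]
  have hMM : M * M = s • M + 1 := by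
    rw [mul_self_eq_trace_smul_sub_det, htrM, hdetM, neg_smul, one_smul, sub_neg_eq_add]
  have heσ : ∀ Q : geomTorsion W ((3 : ℕ) : ℤ), e (σ • Q) = M *ᵥ e Q := fun Q => by
    rw [← galoisRepTorsion_apply, he]
  have hes : ∀ (k : ZMod 3) (Q : geomTorsion W ((3 : ℕ) : ℤ)), e (k • Q) = k • e Q := fun k Q =>
    (e.toAddMonoidHom.toZModLinearMap 3).map_smul k Q
  apply e.injective
  rw [heσ, heσ, Matrix.mulVec_mulVec, hMM, Matrix.add_mulVec, Matrix.smul_mulVec, Matrix.one_mulVec, map_add, hes, heσ]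

/-- **`3Nn` certificate from a Frobenius.** `W/ℚ` elliptic, globally minimal, `W[3]` irreducible, `ρ̄₃` not onto, and a good prime
`ℓ ≡ −1 (mod 3)` with `a_ℓ ≢ 0 (mod 3)`: then `HasModPImageEqNonsplitCartanNormalizer W 3`.
[cite: Serre1972, §2.2–§2.6] [cite: Serre1981, §8.1 (238)] [cite: Zywina2015, §1.2] -/
theorem hasModPImageEqNonsplitCartanNormalizer_three_of_frobenius (W : WeierstrassCurve ℚ) [W.IsElliptic] [W.IsGloballyMinimal]
    (hirr : W.HasIrreducibleModPGaloisRep 3) (hns : ¬ W.HasSurjectiveModNGaloisRep 3)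
    (ℓ : ℕ) [Fact ℓ.Prime] (hℓ3 : ℓ ≠ 3) (hgood : W.HasGoodReductionAtPrime ℓ)
    (htr : ((W.frobeniusTrace ℓ : ℤ) : ZMod 3) = 1 ∨ ((W.frobeniusTrace ℓ : ℤ) : ZMod 3) = -1) (hℓm : ((ℓ : ℕ) : ZMod 3) = -1) :
    HasModPImageEqNonsplitCartanNormalizer W 3 := by
  obtain ⟨σ, hσ⟩ := exists_smul_smul_eq_of_frobeniusTrace W ℓ hℓ3 hgood rfl hℓm
  exact hasModPImageEqNonsplitCartanNormalizer_three_of_sq_eq W hirr hns htr hσ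

open Summit.BirchSwinnertonDyer.BirchSwinnertonDyer.Rank1Residual.IntModel in
/-- **`3Nn` certificate from an integer model and a point count** (the per-row form): `E₀` the integral minimal model of `W`, a prime
`ℓ ∤ Δ(E₀)`, `ℓ ≡ −1 (mod 3)`, `#E₀(𝔽_ℓ) = n` with `ℓ + 1 − n ≢ 0 (mod 3)`, plus `W[3]` irreducible and `ρ̄₃` not onto.
[cite: Serre1972, §2.2–§2.6] [cite: Serre1981, §8.1 (238)] -/
theorem hasModPImageEqNonsplitCartanNormalizer_three_of_intModel {W : WeierstrassCurve ℚ} [W.IsElliptic] [W.IsGloballyMinimal]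
    {E₀ : WeierstrassCurve ℤ} (hI : integralModelInt W = E₀)
    (hirr : W.HasIrreducibleModPGaloisRep 3) (hns : ¬ W.HasSurjectiveModNGaloisRep 3)
    (ℓ : ℕ) [Fact ℓ.Prime] (hℓ3 : ℓ ≠ 3) (hℓΔ : ¬ (ℓ : ℤ) ∣ E₀.Δ) {n : ℕ}
    (hcard : Nat.card ((E₀.map (Int.castRingHom (ZMod ℓ))).toAffine.Point) = n)
    (han : (((ℓ : ℤ) + 1 - n : ℤ) : ZMod 3) = 1 ∨ (((ℓ : ℤ) + 1 - n : ℤ) : ZMod 3) = -1) (hℓm : ((ℓ : ℕ) : ZMod 3) = -1) :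
    HasModPImageEqNonsplitCartanNormalizer W 3 := by
  have hgood : W.HasGoodReductionAtPrime ℓ :=
    hasGoodReductionAtPrime_of_not_dvd W ℓ (by rw [minimalDiscriminantInt_eq hI]; exact hℓΔ)
  have htr : W.frobeniusTrace ℓ = (ℓ : ℤ) + 1 - n := frobeniusTrace_eq hI hcard
  exact hasModPImageEqNonsplitCartanNormalizer_three_of_frobenius W hirr hns ℓ hℓ3 hgood (by rw [htr]; exact han) hℓm

end Summit.BirchSwinnertonDyer.BirchSwinnertonDyer.Theorems.ModThreeNonsplitCartanCertificate

end
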